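import Literature.MathematicalPhysics.QuantumFieldTheory.Balaban1983to89.Node00.TorusCoverGaugeTokensR
import Literature.MathematicalPhysics.QuantumFieldTheory.Balaban1983to89.Node00.TorusCoverBoxStencils

/-!
# NODE 00 — [15] (144) «□̃ ⊂ B_{j−1}(Λ_{j−1}) ∪ B_j(Λ_j) ⊂ Ω_{j−1}» FOR THE CUBE AROUND AN ARBITRARY PLAQUETTE ∕ BOND MEETING `Ω_j` AT THE OBJECTS OF RECORD: the
# Proposition-6 collar `𝔔̃` of the grid cube of a point within distance `D` of `Ω_j` projects into `Ω_{j−1}` (`2 ≤ j ≤ k`, print's separation) ∕ into the support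
# `hullD P M₁ 1 (Ω 1)` (`j = 1`), under the numerics floors `11d + 3L + M + D ≤ M₁` ∕ `(11d + 3L + M)·L + D ≤ M₁` — the «touching» twins of FILE 26's
# `cover_image_tcube_subset_of_seqSeparated` and FILE 29's `cover_image_Ω_cubeIdx'_one_subset_hullD` (which ask the grid cube INSIDE `Ω_j`)

Cell `pub-ymgap`, width seat `pub-ymgap-dag-n07-w4` (director-ym №197 ∕ HUMAN RULING D-0149), node N07 = [15] = [Balaban1985Variational]; [6] = [Balaban1985RegularSpaces];
[III] = [Balaban1988Convergent]; the S3 → S6 junction of plan's `W-SEAT-START-LIST.md` § n07 (this seat's LOCATED-COVER-1 and n07-e g15's «w4 take COVER»).  NEW leaf,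
PROOF kind (no `def`); CONSUMED BY NAME, nothing modified: n07-e FILE 26 `Node00.TorusCoverCubeMember` (`cubeIdx'`, `cubeIdx'_Ω`, `exists_mem_box_within_of_mem_tcube`,
`cover_mem_of_within_of_seqSeparated`, `cubeExt_side_eq_box`), FILE 29 `Node00.TorusCoverGaugeTokensR` (`cover_mem_hullD_one_of_within`), this seat's
`Node00.TorusCoverBoxStencils` (p590855), `B14DomainGeom.(Within, cubeIdx, cubeIdx_le, lt_cubeIdx)`, `B15Eq112TorusCover.(cover, lift)`, def-P11's `Sect2.SeqSeparated`,
`B8Eq17ClassAkV1.plaqsOf`, `B15DeterminingSets.bondsOf`.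

WHY.  Print (p. 300, (144)): «Let us take a cube □ intersecting Ω_j but not Ω_{j+1} … we construct the sequence of cubes {□_n} and the cube □̃ … □̃ ⊂ B_{j−1}(Λ_{j−1}) ∪
B_j(Λ_j) ⊂ Ω_{j−1}» — around «a unit cube Δ₀ ⊂ B_j(Λ_j) containing p or b» (p. 302): the cube of a plaquette MEETING `Ω_j` may stick out of `Ω_j`; what the analysis
needs is that its COLLAR stays in `Ω_{j−1}`, which is print's separation of the sequence ([6] (1.3)–(1.4)).  The tree's per-cube gauge theorems (n07-e 34b
`exists_localGauge10_cube_of_prop6`, 36b `exists_localGauge10_window_of_gaugedBoundB8` ∕ `…_cube_of_prop6P`) take exactly this as the hypothesis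
`hcollar : π 𝔔̃ ⊆ (Ω_{j−1} or the top domain)`; FILE 26 ∕ FILE 29 discharge it for grid cubes INSIDE `Ω_j`.  The per-plaquette ∕ per-bond interface of the S6 assembly
(`…N07HalvingStepTopOfLocalLetters`, `TorusCoverBoxStencils` §2: `Y := π box` of the grid cube of the base corner) needs it for the grid cube of a point merely NEAR
`Ω_j` (within `D = 1` for a plaquette's base corner, `D = 2` for a bond's base corner minus `𝟙`).  THIS FILE: the reach of `𝔔̃ = tcube L (M·a) (M + t) ρ j` from any point of
the grid cube is `(t + 2ρ + M)·Lʲ − 1` (FILE 26's clamp + the cube's own width), so a witness `y ∈ Ω_j` within `D` of the cube puts all of `π 𝔔̃` within `Lʲ·M₁` of `y`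
once `t + 2ρ + M + D ≤ M₁`, and print's separation (`Sect2.SeqSeparated`: one layer of side-`LʲM₁` cubes around `Ω_j` inside `Ω_{j−1}`) resp. the support's layer of
`M₁`-cubes (`hullD`) does the rest.

CONTENTS.  §1 ★ `Sect2.cover_image_tcube_subset_of_within_mem` (`2 ≤ j ≤ k`; generic `t`, `ρ`, witness within `D`), ★ `Sect2.cover_image_tcube_subset_hullD_of_within_mem`
(`j = 1`).  §2 at the Proposition-6 datum of a grid cube (`t = 11d + L`, `ρ = L`): `Sect2.cover_image_cubeIdx'_subset_of_within_mem` ∕ `…_subset_hullD_of_within_mem`;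
per plaquette MEETING `Ω_j` (`p ∈ plaqsOf (Ω j)`, grid cube of `lift p.src`, `D = 1`): ★★ `Sect2.cover_image_cubeIdx'_subset_of_mem_plaqsOf` (`j ≥ 2`),
`Sect2.cover_image_cubeIdx'_subset_hullD_of_mem_plaqsOf` (`j = 1`); per bond MEETING `Ω_j` (`b ∈ bondsOf (Ω j)`, grid cube of `lift b.src − 𝟙`, `D = 2`):
★★ `Sect2.cover_image_cubeIdx'_subset_of_mem_bondsOf`, `Sect2.cover_image_cubeIdx'_subset_hullD_of_mem_bondsOf`.

HONEST FRAMING: integer∕torus bookkeeping under displayed numerics floors (`11d + 3L + M + 2 ≤ M₁`, `(11d + 3L + M)·L + 2 ≤ M₁` — the «touching» surcharge over FILE 26's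
`11d + 3L ≤ M₁` is `M + D`); k0-s1-w3's LOCATED-S5-1 (print's collar `R₁M₁Lⁿ` vs the tree's one layer) is NOT touched — this file places the TREE's datum collar
(`M + 11d + L` blocks + `2L`), not print's; nothing of Bałaban asserted; N07 NOT discharged; K0⁷ ∕ K1⁷ NOT closed; counts unmoved (28∕28 · 5∕27); one finite 𝕋⁴ programme
at fixed ε — R4 closes the conditional rung `BalabanLadder.UV` only: NOT continuum ∕ ℝ⁴ ∕ OS ∕ mass gap ∕ Clay.  Theorems only; no `def`, `instance`, `notation`, `sorry`.
-/

noncomputable section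

namespace Literature.MathematicalPhysics.QuantumFieldTheory.Balaban1983to89.Node00

open B15Eq112TorusCover (cover lift cover_lift)
open B14DomainGeom (Pt Within cubeIdx cubeIdx_le lt_cubeIdx)
open B14.Eq213MaximalDomains (side cubeExt)
open B7Prop1Explicit (e e_apply)
open B8Eq131Cubes (box tcube)
open B15DeterminingSets (bondsOf)

variable {P : Params}

/-! ## §1  The reach of a collar cube from a point near its grid cube -/

section Reach

/-- Two points of one grid cube `cubeExt S a 0` are within `S − 1` of each other (sup-distance). [folklore] -/
private theorem within_of_mem_cubeExt {S : ℕ} {a x x' : Pt P.d} (hx : x ∈ cubeExt S a 0) (hx' : x' ∈ cubeExt S a 0) :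
    Within ((S : ℤ) - 1) x' x := fun i => by
  have h1 := hx i; have h2 := hx' i
  simp only [sub_zero, add_zero] at h1 h2
  rw [abs_le]; constructor <;> linarith [h1.1, h1.2, h2.1, h2.2]

/-- **THE REACH OF THE COLLAR CUBE**: every point `z` of `𝔔̃ = tcube L (M·a) (M + t) ρ j` is within `(t + 2ρ + M)·Lʲ − 1 + D` of any point `y` within `D` of a point
`x` of the grid cube `cubeExt (LʲM) a 0` (FILE 26's clamp `exists_mem_box_within_of_mem_tcube` + the cube's width + the triangle inequality).
[cite: Balaban1985RegularSpaces, p.98 («□̃ … a distance of its boundary to □₀ is equal to 2R₁M₁»); Balaban1985Variational, (144) p.300] -/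
theorem Sect2.within_of_mem_tcube_of_within {M t ρ j : ℕ} (hM : 1 ≤ M) {a x y z : Pt P.d} (hx : x ∈ cubeExt (side P.L M j) a 0) {D : ℤ}
    (hy : Within D x y) (hz : z ∈ tcube P.L (fun i => (M : ℤ) * a i) (M + t) ρ j) :
    Within ((((t + 2 * ρ + M) * P.L ^ j : ℕ) : ℤ) - 1 + D) z y := by
  obtain ⟨x', hx', hzx'⟩ := exists_mem_box_within_of_mem_tcube (L := P.L) P.L_pos _ hM (Nat.le_add_right M t) ρ j hz
  rw [← cubeExt_side_eq_box] at hx'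
  have h1 : Within ((side P.L M j : ℤ) - 1) x' x := within_of_mem_cubeExt hx hx'
  have h := (hzx'.triangle h1).triangle hy
  refine h.mono (le_of_eq ?_)
  rw [Nat.add_sub_cancel_left]
  simp only [side]; push_cast; ring

/-- ★ **«□̃ ⊂ Ω_{j−1}» FOR A CUBE NEAR `Ω_j`, `2 ≤ j ≤ k`**: for a SEPARATED sequence (`Sect2.SeqSeparated M₁ s`: one layer of side-`LʲM₁` cubes around `Ω_j` inside
`Ω_{j−1}`), the collar cube `𝔔̃ = tcube L (M·a) (M + t) ρ j` of a grid cube `cubeExt (LʲM) a 0` containing a point `x` within `D` of a point `y` with `π y ∈ Ω_j` projects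
into `Ω_{j−1}`, provided `t + 2ρ + M + D ≤ M₁` (`D ≥ 0`).  FILE 26's `cover_image_tcube_subset_of_seqSeparated` is the case «grid cube ⊆ Ω_j».
[cite: Balaban1985Variational, (144) p.300; Balaban1985RegularSpaces, (1.3)–(1.4) p.77, p.98; Balaban1988Convergent, (2.13) p.256] -/
theorem Sect2.cover_image_tcube_subset_of_within_mem {D : ℕ → Set (Set (Site P 0))} {k M₁ : ℕ} (hM₁ : 1 ≤ M₁) (s : B14.Eq218Concrete.Seq D k)
    (hsep : Sect2.SeqSeparated M₁ s) {j : ℕ} (hj : 2 ≤ j) (hjk : j ≤ k) {M t ρ : ℕ} (hM : 1 ≤ M) {Dw : ℕ} (hfloor : t + 2 * ρ + M + Dw ≤ M₁)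
    {a x y : Pt P.d} (hx : x ∈ cubeExt (side P.L M j) a 0) (hy : cover P y ∈ s.Ω j) (hxy : Within (Dw : ℤ) x y) :
    cover P '' tcube P.L (fun i => (M : ℤ) * a i) (M + t) ρ j ⊆ s.Ω (j - 1) := by
  rintro _ ⟨z, hz, rfl⟩
  obtain ⟨m, rfl⟩ : ∃ m, j = m + 1 := ⟨j - 1, by omega⟩
  rw [Nat.add_sub_cancel]
  have hw := Sect2.within_of_mem_tcube_of_within hM hx hxy hz
  refine cover_mem_of_within_of_seqSeparated hM₁ s hsep (by omega) (by omega) hy (hw.mono ?_)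
  have hL : (1 : ℤ) ≤ (P.L : ℤ) ^ (m + 1) := by exact_mod_cast Nat.one_le_pow _ _ P.L_pos
  have hf : ((t + 2 * ρ + M + Dw : ℕ) : ℤ) ≤ M₁ := by exact_mod_cast hfloor
  simp only [side]; push_cast at hf ⊢
  nlinarith

/-- ★ **«□̃ ⊂ Ω₀» FOR A CUBE NEAR `Ω₁` (`j = 1`): the collar projects into the SUPPORT `hullD P M₁ 1 (Ω 1)`** (one layer of side-`M₁` cubes around `Ω₁`, def-R's
`suppDomOfRecord`'s shape) provided `(t + 2ρ + M)·L + D ≤ M₁`.  FILE 29's `cover_image_Ω_cubeIdx'_one_subset_hullD` is the case «grid cube ⊆ Ω₁».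
[cite: Balaban1985Variational, (144) p.300, (1) p.277; Balaban1988Convergent, p.255 («a layer of M₁-cubes»); Balaban1985RegularSpaces, p.98] -/
theorem Sect2.cover_image_tcube_subset_hullD_of_within_mem {M₁ : ℕ} {Ω₁ : Set (Site P 0)} {M t ρ : ℕ} (hM : 1 ≤ M) {Dw : ℕ}
    (hfloor : (t + 2 * ρ + M) * P.L + Dw ≤ M₁) {a x y : Pt P.d} (hx : x ∈ cubeExt (side P.L M 1) a 0) (hy : cover P y ∈ Ω₁)
    (hxy : Within (Dw : ℤ) x y) : cover P '' tcube P.L (fun i => (M : ℤ) * a i) (M + t) ρ 1 ⊆ hullD P M₁ 1 Ω₁ := by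
  rintro _ ⟨z, hz, rfl⟩
  have hM₁ : 0 < M₁ := by
    have : 1 ≤ (t + 2 * ρ + M) * P.L := Nat.one_le_iff_ne_zero.mpr (Nat.mul_ne_zero (by omega) (by have := P.hL.2; omega))
    omega
  have hw := Sect2.within_of_mem_tcube_of_within hM hx hxy hz
  refine cover_mem_hullD_one_of_within hM₁ hy (hw.mono ?_)
  have hf : (((t + 2 * ρ + M) * P.L + Dw : ℕ) : ℤ) ≤ M₁ := by exact_mod_cast hfloor
  push_cast at hf ⊢
  linarith

end Reach

/-! ## §2  At the Proposition-6 datum of a grid cube, for plaquettes and bonds MEETING `Ω_j` -/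

section Datum

/-- The lift of a torus site lies in the grid cube of its index: `lift y ∈ cubeExt S (cubeIdx S (lift y)) 0`. [folklore] -/
private theorem mem_cubeExt_cubeIdx {S : ℕ} (hS : 0 < S) (x : Pt P.d) : x ∈ cubeExt S (cubeIdx S x) 0 := fun i => by
  simp only [sub_zero, add_zero]
  exact ⟨cubeIdx_le S hS x i, by have := lt_cubeIdx S hS x i; omega⟩

/-- A plaquette MEETING a site set has a corner `π(x + v)`, `x = lift p.src`, `v ∈ {0, e_μ, e_ν, e_μ + e_ν}`, in it — so a witness within `1` of `x`.
[cite: Balaban1985RegularSpaces, p.77 (convention before (1.5)); Balaban1987RG1, (0.1) p.251 (bookkeeping)] -/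
private theorem exists_within_one_of_mem_plaqsOf {X : Set (Site P 0)} {p : Plaq P 0} (hp : p ∈ B8Eq17ClassAkV1.plaqsOf X) :
    ∃ y : Pt P.d, cover P y ∈ X ∧ Within (1 : ℕ) (lift P p.src) y := by
  set x := lift P p.src with hx
  have hsrc : p.src = cover P x := by rw [hx, cover_lift]
  have w1 : ∀ μ : Fin P.d, Within ((1 : ℕ) : ℤ) x (x + e μ) := fun μ i => by
    simp only [Pi.add_apply, e_apply]; split_ifs <;> simp
  have w2 : ∀ μ ν : Fin P.d, μ ≠ ν → Within ((1 : ℕ) : ℤ) x (x + e μ + e ν) := fun μ ν hμν i => by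
    simp only [Pi.add_apply, e_apply]
    by_cases h1 : i = μ
    · subst h1; simp [if_neg hμν]
    · simp only [if_neg h1]; split_ifs <;> simp
  rcases hp with h | h | h | h
  · exact ⟨x, by rwa [← hsrc], Within.refl (by norm_num) x⟩
  · exact ⟨x + e p.μ, by rwa [cover_add_e, ← hsrc], w1 _⟩
  · exact ⟨x + e p.ν, by rwa [cover_add_e, ← hsrc], w1 _⟩
  · exact ⟨x + e p.μ + e p.ν, by rwa [cover_add_e, cover_add_e, ← hsrc], w2 _ _ (ne_of_lt p.hμν)⟩

/-- A bond MEETING a site set has an endpoint `π x` or `π(x + e_μ)`, `x = lift b.src`, in it — a witness within `2` of `x − 𝟙`.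
[cite: Balaban1985RegularSpaces, p.77 (convention before (1.5)); Balaban1987RG1, (0.1) p.251 (bookkeeping)] -/
private theorem exists_within_two_of_mem_bondsOf {X : Set (Site P 0)} {b : PBond P 0} (hb : b ∈ bondsOf X) :
    ∃ y : Pt P.d, cover P y ∈ X ∧ Within (2 : ℕ) (lift P b.src - fun _ => 1) y := by
  set x := lift P b.src with hx
  have hsrc : b.src = cover P x := by rw [hx, cover_lift]
  rcases hb with h | h
  · refine ⟨x, by rwa [← hsrc], fun i => ?_⟩
    simp only [Pi.sub_apply, Nat.cast_ofNat]
    rw [abs_le]; constructor <;> linarith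
  · refine ⟨x + e b.dir, by rw [cover_add_e, ← hsrc]; exact h, fun i => ?_⟩
    simp only [Pi.sub_apply, Pi.add_apply, e_apply, Nat.cast_ofNat]
    rw [abs_le]; split_ifs <;> constructor <;> linarith

/-- ★★ **(144) FOR THE CUBE OF A PLAQUETTE MEETING `Ω_j`, `2 ≤ j ≤ k`**: the Proposition-6 collar `𝔔̃` of the datum `cubeIdx' P j _ M a`, `a = cubeIdx (LʲM) (lift p.src)`
(the grid cube of the plaquette's base corner — the cube in whose datum box `TorusCoverBoxStencils` §2 places `p`), projects into `Ω_{j−1}` for every `p ∈ plaqsOf (Ω j)` of a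
separated sequence, under the floor `11d + 3L + M + 1 ≤ M₁` — the `hcollar` hypothesis of the per-cube gauge theorems (34b ∕ 36b) AT THAT CUBE.
[cite: Balaban1985Variational, (144) p.300, p.302; Balaban1985RegularSpaces, (1.3)–(1.4) p.77, p.98; Balaban1988Convergent, (2.13) p.256] -/
theorem Sect2.cover_image_cubeIdx'_subset_of_mem_plaqsOf {D : ℕ → Set (Set (Site P 0))} {k M₁ : ℕ} (hM₁ : 1 ≤ M₁) (s : B14.Eq218Concrete.Seq D k)
    (hsep : Sect2.SeqSeparated M₁ s) {j : ℕ} (hj : 2 ≤ j) (hjk : j ≤ k) {M : ℕ} (hM : 1 ≤ M) (hfloor : 11 * P.d + 3 * P.L + M + 1 ≤ M₁)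
    {p : Plaq P 0} (hp : p ∈ B8Eq17ClassAkV1.plaqsOf (s.Ω j)) (i : ℕ) :
    cover P '' (cubeIdx' P j (by omega) M (cubeIdx (side P.L M j) (lift P p.src))).Ω i ⊆ s.Ω (j - 1) := by
  obtain ⟨y, hy, hxy⟩ := exists_within_one_of_mem_plaqsOf hp
  rw [cubeIdx'_Ω, show M + 11 * P.d + P.L = M + (11 * P.d + P.L) by ring]
  exact Sect2.cover_image_tcube_subset_of_within_mem hM₁ s hsep hj hjk hM (Dw := 1) (by omega)
    (mem_cubeExt_cubeIdx (B14.Eq213MaximalDomains.side_pos P.L_pos hM j) _) hy hxy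

/-- **(144) FOR THE CUBE OF A PLAQUETTE MEETING `Ω₁` (`j = 1`)**: the collar projects into the support `hullD P M₁ 1 (Ω 1)`, floor `(11d + 3L + M)·L + 1 ≤ M₁`.
[cite: Balaban1985Variational, (144) p.300, (1) p.277; Balaban1988Convergent, p.255; Balaban1985RegularSpaces, p.98] -/
theorem Sect2.cover_image_cubeIdx'_subset_hullD_of_mem_plaqsOf {M₁ : ℕ} {Ω₁ : Set (Site P 0)} {M : ℕ} (hM : 1 ≤ M)
    (hfloor : (11 * P.d + 3 * P.L + M) * P.L + 1 ≤ M₁) {p : Plaq P 0} (hp : p ∈ B8Eq17ClassAkV1.plaqsOf Ω₁) (i : ℕ) :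
    cover P '' (cubeIdx' P 1 le_rfl M (cubeIdx (side P.L M 1) (lift P p.src))).Ω i ⊆ hullD P M₁ 1 Ω₁ := by
  obtain ⟨y, hy, hxy⟩ := exists_within_one_of_mem_plaqsOf hp
  rw [cubeIdx'_Ω, show M + 11 * P.d + P.L = M + (11 * P.d + P.L) by ring]
  exact Sect2.cover_image_tcube_subset_hullD_of_within_mem hM (Dw := 1) (by nlinarith [hfloor])
    (mem_cubeExt_cubeIdx (B14.Eq213MaximalDomains.side_pos P.L_pos hM 1) _) hy hxy

/-- ★★ **(144) FOR THE CUBE OF A BOND MEETING `Ω_j`, `2 ≤ j ≤ k`**: the collar of the datum of the grid cube of `lift b.src − 𝟙` (the cube in whose datum box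
`TorusCoverBoxStencils` §2 places the bond's (1.2)-stencil) projects into `Ω_{j−1}` for every `b ∈ bondsOf (Ω j)`, floor `11d + 3L + M + 2 ≤ M₁`.
[cite: Balaban1985Variational, (144) p.300, p.302; Balaban1985RegularSpaces, (1.2) p.76, (1.3)–(1.4) p.77, p.98; Balaban1988Convergent, (2.13) p.256] -/
theorem Sect2.cover_image_cubeIdx'_subset_of_mem_bondsOf {D : ℕ → Set (Set (Site P 0))} {k M₁ : ℕ} (hM₁ : 1 ≤ M₁) (s : B14.Eq218Concrete.Seq D k)
    (hsep : Sect2.SeqSeparated M₁ s) {j : ℕ} (hj : 2 ≤ j) (hjk : j ≤ k) {M : ℕ} (hM : 1 ≤ M) (hfloor : 11 * P.d + 3 * P.L + M + 2 ≤ M₁)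
    {b : PBond P 0} (hb : b ∈ bondsOf (s.Ω j)) (i : ℕ) :
    cover P '' (cubeIdx' P j (by omega) M (cubeIdx (side P.L M j) (lift P b.src - fun _ => 1))).Ω i ⊆ s.Ω (j - 1) := by
  obtain ⟨y, hy, hxy⟩ := exists_within_two_of_mem_bondsOf hb
  rw [cubeIdx'_Ω, show M + 11 * P.d + P.L = M + (11 * P.d + P.L) by ring]
  exact Sect2.cover_image_tcube_subset_of_within_mem hM₁ s hsep hj hjk hM (Dw := 2) (by omega)
    (mem_cubeExt_cubeIdx (B14.Eq213MaximalDomains.side_pos P.L_pos hM j) _) hy hxy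

/-- **(144) FOR THE CUBE OF A BOND MEETING `Ω₁` (`j = 1`)**: the collar projects into the support `hullD P M₁ 1 (Ω 1)`, floor `(11d + 3L + M)·L + 2 ≤ M₁`.
[cite: Balaban1985Variational, (144) p.300, (1) p.277; Balaban1988Convergent, p.255; Balaban1985RegularSpaces, (1.2) p.76, p.98] -/
theorem Sect2.cover_image_cubeIdx'_subset_hullD_of_mem_bondsOf {M₁ : ℕ} {Ω₁ : Set (Site P 0)} {M : ℕ} (hM : 1 ≤ M)
    (hfloor : (11 * P.d + 3 * P.L + M) * P.L + 2 ≤ M₁) {b : PBond P 0} (hb : b ∈ bondsOf Ω₁) (i : ℕ) :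
    cover P '' (cubeIdx' P 1 le_rfl M (cubeIdx (side P.L M 1) (lift P b.src - fun _ => 1))).Ω i ⊆ hullD P M₁ 1 Ω₁ := by
  obtain ⟨y, hy, hxy⟩ := exists_within_two_of_mem_bondsOf hb
  rw [cubeIdx'_Ω, show M + 11 * P.d + P.L = M + (11 * P.d + P.L) by ring]
  exact Sect2.cover_image_tcube_subset_hullD_of_within_mem hM (Dw := 2) (by nlinarith [hfloor])
    (mem_cubeExt_cubeIdx (B14.Eq213MaximalDomains.side_pos P.L_pos hM 1) _) hy hxy

end Datum

end Literature.MathematicalPhysics.QuantumFieldTheory.Balaban1983to89.Node00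

end
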